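import Summits.BirchSwinnertonDyer.BirchSwinnertonDyer.Theorems.ResidualThetaTransportAtTwoResidualSignedLambdaLowerCMAtTwoCofreeSelmerTransferSigned
import Summits.BirchSwinnertonDyer.BirchSwinnertonDyer.Theorems.ThetaPartnerAtTwoSignedMainConjectureCMTwoRankZeroPTDeepTransfer
import HarnessLib

/-!
# The RELAXED (tower-points) local step of S4₂ at `v ∣ p`: (M) `τ_n c ∈ SelRel` for every conjugate and (V) the EXACT Θ-Kummer datum of `τ_n c`
# at `σ = 1` — and GLUE-67 typed: (M) + (V) + (VAL-rel) + (H) ⟹ `z(Q₀) ≡ 0 (mod p^k)`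

Route `ResidualThetaTransportAtTwo` (RTT), crux RSL_g `ResidualSignedLambdaLowerCMAtTwo` (stmt-BirchSwinnertonDyer-22608), line «onepair», split item
S4₂ `stub_deepHalfAtTwoStrict`; seat `prover-bsd-wall-tp2-p2x-w2` g19 (`--supports`, closes nothing). THEOREMS ONLY (no definition, no named fact,
no instance, no `sorry`). STUB-PLAN rev 21.1 **Q87 (a)(b)** + **S85/S86** (critic g21): the test space of the split texts is `↥SelRel` whose clause at
`v ∣ 2` is the RELAXED one (tower points, all `σ`; SKELETON-V2-CUT-g16 (C4)), and the VALUE `c₂ z (loc₂ (τ b))` is read off the EXACT transported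
datum `(φ, R, k)` with `2^k • R i = Q₀ i` — so S4₂ consumes (M) + (V) below, not the PLUS clause of `…CofreeSelmerTransferSigned`
(which stays correct and optional). Kernel text for (a)/(b) exists twice in the crux's Ideas (k3-g14 `ThetaKummerAt.resOfLe` / `conjH1_transferH1_kummer_towerPoints`,
k2-g15 §3–§5); this file re-bases it on p693471's class currency so GLUE-67 composes without a bridge. BSD is not proved by any of this; RSL_g (22608)
stays OPEN.

* §1 (V) **`exists_thetaKummerWitness_transfer`** (Q87 (a)): the exact datum of `τ_n c = res_{Γ_∞ ≤ Γ_n}((A_ρ[p^k] ↪ A_ρ)_* c)` at `σ = 1` —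
  `∃ φ R, [φ] = τ_n c ∧ (∀ i, p^k • R i = Q₀ i) ∧ ι(Θ(φ(res τ))_i) = τ R_i − R_i` on `Gal(ℚ̄_v/ℚ_{∞,v})` (p693471 §1 restricted, the equality KEPT).
* §2 (M, local part) **`exists_tower_thetaKummerWitness_conjH1_transfer`** (Q87 (b)): for EVERY `σ ∈ Γ_ℚ` a datum `(φ, Q, k)` of `conj_σ (τ_n c)` with
  `p^k • Q i ∈ E(ℚ_{∞,v})` (tower points; NO sign hypothesis on `Q₀`: layer points are tower points, `Sprung2012.localLayerPointsOfEmb_le_localTowerPointsOfEmb`,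
  and tower points are `Γ_v`-stable, `Sprung2012.smul_mem_localTowerPointsOfEmb`) — VERBATIM the shape of (C4)'s clause at `v ∣ 2`.
* §3 (M) **`transferH1_mem_selRel_of_shapiroLift`**: [unr] ∧ [inf] (LOCAL CONDITIONS on `Sh c`, as `transferH1_mem_relaxed_of_shapiroLift`) ∧ [kum] at THE
  place `v ∋ p` ⟹ `τ_n c ∈ {y | unr ∧ (∀ w σ, conj_σ y ∈ infKer w) ∧ ∀ v' ∋ p, ∀ σ, ∃ φ Q k, [φ] = conj_σ y ∧ (∀ i, p^k • Q i ∈ E(ℚ_{∞,v'})) ∧ Θ-Kummer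
  identity through `Θ v' hv'`}` = SelRel₍C4₎ literally (at `p = 2`; the only place above `p` is `v`, `eq_of_natCast_mem_asIdeal`).
* §4 GLUE-67 typed (S86) **`toZModPow_eq_zero_of_transfer`**: with `Rel ⊇` the §3 literal, `C : H¹(Γ_∞, A_ρ) → ℚ/ℤ` (the split's `s ↦ c₂ z (loc₂ s)`),
  `z : E(ℚ_{∞,v})^r → ℤ_p` (the target functional), the SelRel-wide (VAL-rel) pin «`C s = (z(p^k • Q) mod p^k)·p^{-k}` for every tower datum
  `(φ, Q, k)` of `s ∈ Rel`» (S2's (VAL) formula, `…StubPlusColemanO` l. 42, Q88) and (H) «`C = 0` on `Rel`»: `z(Q₀) ≡ 0 (mod p^k)` — the conclusion of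
  tp2-p2x LEAD g18's `hT` (`…DeepHalfAtTwoLevelwise`, p694426). Arithmetic: `SignedLowerOffTwo.PTDeep.toZModPow_eq_zero_of_val_smul_invPow_eq_zero`.

References: [Kobayashi2003] Def. 1.1, §2 (p. 4), (8.23) (p. 18); [Sprung2012] §1 p. 1486, Lemma 7.10; [SerreGaloisCohomology1997] I §2.4–2.5;
[SerreLocalFields1979] VII §5 Prop. 3; [MilneADT2006] I 4.10 (b); [Rubin2000] App. B §B.3.
-/

set_option autoImplicit false
-- the Theorems namespace of this sub repeats the summit name by design (D-0017 nested layout)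
set_option linter.dupNamespace false

noncomputable section

open scoped Classical NumberField

namespace Summit.BirchSwinnertonDyer.BirchSwinnertonDyer.Theorems.ThetaTransport.CofreeSelmerTransfer

open CategoryTheory Field NumberField IsDedekindDomain
  Literature.NumberTheory.EllipticCurves Literature.NumberTheory.GaloisRepresentations
  Literature.NumberTheory.EllipticCurves.Kobayashi2003 Literature.NumberTheory.EllipticCurves.GreenbergVatsal2000
  Literature.NumberTheory.EllipticCurves.GreenbergSelmer Literature.NumberTheory.EllipticCurves.CyclotomicLayer
  Literature.NumberTheory.EllipticCurves.Sprung2012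
  Literature.NumberTheory.GaloisCohomology ZpExtension
  Literature.NumberTheory.GaloisRepresentations.DiscreteGaloisModule
  Summit.BirchSwinnertonDyer.BirchSwinnertonDyer.Theorems

/-- Places of `ℚ` containing the same rational prime coincide (`(ℓ)` is maximal in `𝓞 ℚ ≅ ℤ`; twin of the tree's private copies, e.g.
`Literature.NumberTheory.EllipticCurves.HeightOneSpectrum.eq_of_natCast_mem_rat`). [folklore] -/
theorem heightOneSpectrum_eq_of_natCast_mem {ℓ : ℕ} (hℓ : ℓ.Prime) {v v' : HeightOneSpectrum (𝓞 ℚ)}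
    (hv : (ℓ : 𝓞 ℚ) ∈ v.asIdeal) (hv' : (ℓ : 𝓞 ℚ) ∈ v'.asIdeal) : v' = v := by
  have hprime : Prime (ℓ : 𝓞 ℚ) := by
    rw [← MulEquiv.prime_iff (Rat.ringOfIntegersEquiv : 𝓞 ℚ ≃+* ℤ).toMulEquiv]
    change Prime (Rat.ringOfIntegersEquiv (ℓ : 𝓞 ℚ))
    rw [map_natCast, ← Nat.prime_iff_prime_int]
    exact hℓ
  have hP : (Ideal.span {(ℓ : 𝓞 ℚ)}).IsPrime := (Ideal.span_singleton_prime hprime.ne_zero).mpr hprime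
  have hmax := hP.isMaximal (by rw [Ne, Ideal.span_singleton_eq_bot]; exact hprime.ne_zero)
  have h1 := hmax.eq_of_le v.isPrime.ne_top ((Ideal.span_singleton_le_iff_mem _).mpr hv)
  have h2 := hmax.eq_of_le v'.isPrime.ne_top ((Ideal.span_singleton_le_iff_mem _).mpr hv')
  exact HeightOneSpectrum.ext (h2.symm.trans h1)

section OnePlace

variable {p : ℕ} [Fact p.Prime] (S : Set (PadicAlgCl p)) {d : ℕ} (ρ : FramedGaloisRep ℚ ↥(padicCoeffIntegers S) d)
  (k : ℕ) (W : WeierstrassCurve ℚ) [W.IsElliptic] {r : ℕ}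
  (Θ : Cofree ρ ↥(padicCoeffField S) ≃+ (Fin r → ↥(W.geomPrimaryTorsion p))) (κ : ZpExtension ℚ p)
  (v : HeightOneSpectrum (𝓞 ℚ))
  (hΘ : ∀ (δ : absoluteGaloisGroup (v.adicCompletion ℚ)) (m : Cofree ρ ↥(padicCoeffField S)) (i : Fin r),
    Θ (resGalOfEmb (closureEmb (K := ℚ) (v.adicCompletion ℚ)) δ • m) i =
      resGalOfEmb (closureEmb (K := ℚ) (v.adicCompletion ℚ)) δ • Θ m i)

/-! ## §1 (V) The EXACT Θ-Kummer datum of the transferred class at `σ = 1` -/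

-- the coercion towers `A_ρ[p^k] ↪ A_ρ →Θ E[p^∞]^r ↪ E(ℚ̄)^r → E(ℚ̄_v)^r` (as in `…CofreeSelmerTransferKummer`)
set_option maxHeartbeats 1600000 in
include hΘ in
/-- **(V) the exact datum of `τ_n c` (Q87 (a)).** If `layerLocOf … κ v n c = thetaLayerKummer … Q₀` (ANY layer points `Q₀`, no sign condition) then
`τ_n c = res_{Γ_∞ ≤ Γ_n}((A_ρ[p^k] ↪ A_ρ)_* c) ∈ H¹(Γ_∞, A_ρ)` has a representative `φ` and points `R` with `p^k • R i = Q₀ i` (equality KEPT)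
and `ι(Θ(φ(res τ))_i) = τ R_i − R_i` on `Gal(ℚ̄_v/ℚ_{∞,v})` — p693471 §1 restricted to `Γ_∞`. This is the datum through which the split's value
`c₂ z (loc₂ (τ_n c))` is read ((VAL-rel), §4). [cite: Kobayashi2003, §2 (p. 4), (8.23) (p. 18)] [cite: SerreGaloisCohomology1997, I §2.4] -/
theorem exists_thetaKummerWitness_transfer (n : ℕ)
    (c : H1 (cofreeTorsionGaloisModule S ρ ((p ^ k : ℕ) : ℤ)) (κ.layerSubgroup n))
    (Q₀ : Fin r → ↥(localLayerPointsOfEmb κ (closureEmb (K := ℚ) (v.adicCompletion ℚ)) W n))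
    (hkum : layerLocOf (cofreeTorsionGaloisModule S ρ ((p ^ k : ℕ) : ℤ)) κ v n c =
      thetaLayerKummer S ρ k W Θ κ v hΘ n Q₀) :
    ∃ (φ : contOneCocycles (discreteTopRep κ.kerSubgroup (Cofree ρ ↥(padicCoeffField S))))
      (R : Fin r → localPoints W (v.adicCompletion ℚ)),
      oneCocycleClass (discreteTopRep κ.kerSubgroup (Cofree ρ ↥(padicCoeffField S))) φ =
        resOfLe (Cofree ρ ↥(padicCoeffField S)) (κ.kerSubgroup_le_layerSubgroup n)
          (pushH1 (κ.layerSubgroup n) (AddSubgroup.torsionBy (Cofree ρ ↥(padicCoeffField S)) ((p ^ k : ℕ) : ℤ)).subtype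
            (fun _ _ ↦ rfl) c) ∧
      (∀ i, (p ^ k) • R i = (Q₀ i : localPoints W (v.adicCompletion ℚ))) ∧
      ∀ (τ : localSubgroupOfEmb κ.kerSubgroup (closureEmb (K := ℚ) (v.adicCompletion ℚ))) (i : Fin r),
        pointsMapOfEmb W (closureEmb (K := ℚ) (v.adicCompletion ℚ))
            ((Θ (φ.1 (resGalSubgroupOfEmb κ.kerSubgroup (closureEmb (K := ℚ) (v.adicCompletion ℚ)) τ)) i :
              ↥(W.geomPrimaryTorsion p)) : W.geomPoints) =
          (τ : absoluteGaloisGroup (v.adicCompletion ℚ)) • R i - R i := by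
  obtain ⟨β, R, hβc, hR, hβ⟩ := exists_thetaKummerWitness_of_layerLocOf_eq_thetaLayerKummer S ρ k W Θ κ v hΘ n c Q₀ hkum
  refine ⟨contOneCocycles.pullback (subgroupInclusion (κ.kerSubgroup_le_layerSubgroup n))
      (resHomOfEquivariant (subgroupInclusion (κ.kerSubgroup_le_layerSubgroup n)) (AddMonoidHom.id (Cofree ρ ↥(padicCoeffField S)))
        (fun _ _ ↦ rfl))
      (contOneCocycles.pullback (ContinuousMonoidHom.id (κ.layerSubgroup n))
        (resHomOfEquivariant (ContinuousMonoidHom.id (κ.layerSubgroup n))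
          (AddSubgroup.torsionBy (Cofree ρ ↥(padicCoeffField S)) ((p ^ k : ℕ) : ℤ)).subtype (fun _ _ ↦ rfl)) β),
    R, ?_, hR, fun τ i ↦ ?_⟩
  · rw [← hβc, resH1Hom_oneCocycleClass, ResidualLayer.resOfLe_oneCocycleClass]
  · have hτn : (τ : absoluteGaloisGroup (v.adicCompletion ℚ)) ∈ layerGroup κ v n :=
      κ.kerSubgroup_le_layerSubgroup n ((mem_localSubgroupOfEmb_iff κ.kerSubgroup (closureEmb (K := ℚ) (v.adicCompletion ℚ)) _).1 τ.2)
    have e2 : subgroupInclusion (κ.kerSubgroup_le_layerSubgroup n)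
        (resGalSubgroupOfEmb κ.kerSubgroup (closureEmb (K := ℚ) (v.adicCompletion ℚ)) τ) =
        resGalSubgroupOfEmb (κ.layerSubgroup n) (closureEmb (K := ℚ) (v.adicCompletion ℚ))
          ⟨(τ : absoluteGaloisGroup (v.adicCompletion ℚ)), hτn⟩ :=
      Subtype.ext rfl
    rw [contOneCocycles.pullback_apply, contOneCocycles.pullback_apply]
    change pointsMapOfEmb W (closureEmb (K := ℚ) (v.adicCompletion ℚ)) ((Θ (((β.1
      (subgroupInclusion (κ.kerSubgroup_le_layerSubgroup n)
        (resGalSubgroupOfEmb κ.kerSubgroup (closureEmb (K := ℚ) (v.adicCompletion ℚ)) τ)) :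
          ↥(AddSubgroup.torsionBy (Cofree ρ ↥(padicCoeffField S)) ((p ^ k : ℕ) : ℤ))) :
        Cofree ρ ↥(padicCoeffField S))) i : ↥(W.geomPrimaryTorsion p)) : W.geomPoints) = _
    rw [e2]
    exact hβ ⟨_, hτn⟩ i

/-! ## §2 (M, local part) The RELAXED datum for every conjugate: `p^k • Q i ∈ E(ℚ_{∞,v})` -/

-- same coercion towers (the witness is transported through `conj`, `push`, `res`)
set_option maxHeartbeats 1600000 in
include hΘ in
/-- **(M, local part) the tower-points datum of every conjugate (Q87 (b)).** `κ` cyclotomic, `v ∋ p`, `layerLocOf … c = thetaLayerKummer … Q₀`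
for ANY layer points `Q₀` (no sign hypothesis). Then for EVERY `σ ∈ Γ_ℚ`, `conj_σ (τ_n c)` has a datum `(φ, Q, k)`: `[φ] = conj_σ (τ_n c)`,
`p^k • Q i ∈ E(ℚ_{∞,v})` (tower points), and `ι(Θ(φ(res τ))_i) = τ Q_i − Q_i` on `Gal(ℚ̄_v/ℚ_{∞,v})` — VERBATIM the clause at `v ∣ 2` of SelRel₍C4₎
(there `p = 2`, `Θ = Θ v hv`). Proof = p693471 §3 with `Q = d • R` and `Sprung2012.smul_mem_localTowerPointsOfEmb` (layer points are tower
points, tower points are `Γ_v`-stable). [cite: Kobayashi2003, Def. 1.1, §2 (p. 4)] [cite: Sprung2012, §1 p. 1486, Lemma 7.10]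
[cite: SerreLocalFields1979, VII §5 Prop. 3] -/
theorem exists_tower_thetaKummerWitness_conjH1_transfer (hκ : κ.IsCyclotomic) (hv : (p : 𝓞 ℚ) ∈ v.asIdeal) (n : ℕ)
    (c : H1 (cofreeTorsionGaloisModule S ρ ((p ^ k : ℕ) : ℤ)) (κ.layerSubgroup n))
    (Q₀ : Fin r → ↥(localLayerPointsOfEmb κ (closureEmb (K := ℚ) (v.adicCompletion ℚ)) W n))
    (hkum : layerLocOf (cofreeTorsionGaloisModule S ρ ((p ^ k : ℕ) : ℤ)) κ v n c =
      thetaLayerKummer S ρ k W Θ κ v hΘ n Q₀)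
    (σ : absoluteGaloisGroup ℚ) :
    ∃ (φ : contOneCocycles (discreteTopRep κ.kerSubgroup (Cofree ρ ↥(padicCoeffField S))))
      (Q : Fin r → localPoints W (v.adicCompletion ℚ)) (k' : ℕ),
      oneCocycleClass (discreteTopRep κ.kerSubgroup (Cofree ρ ↥(padicCoeffField S))) φ =
        conjH1 κ.kerSubgroup (Cofree ρ ↥(padicCoeffField S)) σ
          (resOfLe (Cofree ρ ↥(padicCoeffField S)) (κ.kerSubgroup_le_layerSubgroup n)
            (pushH1 (κ.layerSubgroup n) (AddSubgroup.torsionBy (Cofree ρ ↥(padicCoeffField S)) ((p ^ k : ℕ) : ℤ)).subtype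
              (fun _ _ ↦ rfl) c)) ∧
      (∀ i, (p ^ k') • Q i ∈ localTowerPointsOfEmb κ (closureEmb (K := ℚ) (v.adicCompletion ℚ)) W) ∧
      ∀ (τ : localSubgroupOfEmb κ.kerSubgroup (closureEmb (K := ℚ) (v.adicCompletion ℚ))) (i : Fin r),
        pointsMapOfEmb W (closureEmb (K := ℚ) (v.adicCompletion ℚ))
            ((Θ (φ.1 (resGalSubgroupOfEmb κ.kerSubgroup (closureEmb (K := ℚ) (v.adicCompletion ℚ)) τ)) i :
              ↥(W.geomPrimaryTorsion p)) : W.geomPoints) =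
          (τ : absoluteGaloisGroup (v.adicCompletion ℚ)) • Q i - Q i := by
  -- one orbit: `σ = θ(d) · u`, `u ∈ Γ_n`
  obtain ⟨dd, hd⟩ := SignedKatoOffTwo.LayerPairing.forall_exists_inv_mul_mem_layerSubgroup κ v hκ hv n σ
  have hσ : σ = resGalOfEmb (closureEmb (K := ℚ) (v.adicCompletion ℚ)) dd *
      ((resGalOfEmb (closureEmb (K := ℚ) (v.adicCompletion ℚ)) dd)⁻¹ * σ) := by rw [mul_inv_cancel_left]
  -- the witness at level `n`
  obtain ⟨β, R, hβc, hR, hβ⟩ := exists_thetaKummerWitness_of_layerLocOf_eq_thetaLayerKummer S ρ k W Θ κ v hΘ n c Q₀ hkum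
  refine ⟨contOneCocycles.pullback (subgroupInclusion (κ.kerSubgroup_le_layerSubgroup n))
      (resHomOfEquivariant (subgroupInclusion (κ.kerSubgroup_le_layerSubgroup n)) (AddMonoidHom.id (Cofree ρ ↥(padicCoeffField S)))
        (fun _ _ ↦ rfl))
      (contOneCocycles.pullback (ContinuousMonoidHom.id (κ.layerSubgroup n))
        (resHomOfEquivariant (ContinuousMonoidHom.id (κ.layerSubgroup n))
          (AddSubgroup.torsionBy (Cofree ρ ↥(padicCoeffField S)) ((p ^ k : ℕ) : ℤ)).subtype (fun _ _ ↦ rfl))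
        (conjCocycle (κ.layerSubgroup n) (resGalOfEmb (closureEmb (K := ℚ) (v.adicCompletion ℚ)) dd) β)),
    fun i ↦ dd • R i, k, ?_, fun i ↦ ?_, fun τ i ↦ ?_⟩
  · -- the class
    have e1 : conjH1 κ.kerSubgroup (Cofree ρ ↥(padicCoeffField S)) σ
        (resOfLe (Cofree ρ ↥(padicCoeffField S)) (κ.kerSubgroup_le_layerSubgroup n)
          (pushH1 (κ.layerSubgroup n) (AddSubgroup.torsionBy (Cofree ρ ↥(padicCoeffField S)) ((p ^ k : ℕ) : ℤ)).subtype
            (fun _ _ ↦ rfl) c)) =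
        resOfLe (Cofree ρ ↥(padicCoeffField S)) (κ.kerSubgroup_le_layerSubgroup n)
          (pushH1 (κ.layerSubgroup n) (AddSubgroup.torsionBy (Cofree ρ ↥(padicCoeffField S)) ((p ^ k : ℕ) : ℤ)).subtype
            (fun _ _ ↦ rfl) (conjH1 (κ.layerSubgroup n) ↥(AddSubgroup.torsionBy (Cofree ρ ↥(padicCoeffField S)) ((p ^ k : ℕ) : ℤ))
              (resGalOfEmb (closureEmb (K := ℚ) (v.adicCompletion ℚ)) dd) c)) := by
      have e := congrArg (fun f ↦ f (pushH1 (κ.layerSubgroup n)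
        (AddSubgroup.torsionBy (Cofree ρ ↥(padicCoeffField S)) ((p ^ k : ℕ) : ℤ)).subtype (fun _ _ ↦ rfl) c))
        (resOfLe_comp_conjH1_holds (M := Cofree ρ ↥(padicCoeffField S)) (κ.kerSubgroup_le_layerSubgroup n) σ)
      simp only [AddMonoidHom.coe_comp, Function.comp_apply] at e
      rw [← e, ThetaTransport.conjH1_pushH1, hσ, conjH1_mul_holds, AddMonoidHom.comp_apply,
        conjH1_of_mem_holds (κ.layerSubgroup n) ↥(AddSubgroup.torsionBy (Cofree ρ ↥(padicCoeffField S)) ((p ^ k : ℕ) : ℤ)) hd,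
        AddMonoidHom.id_apply]
    rw [e1, ← hβc, conjH1_oneCocycleClass, resH1Hom_oneCocycleClass, ResidualLayer.resOfLe_oneCocycleClass]
  · -- `p^k • (d • R i) = d • Q₀ i ∈ E(ℚ_{∞,v})` (layer points are tower points; tower points are `Γ_v`-stable)
    rw [smul_comm, hR i]
    exact smul_mem_localTowerPointsOfEmb κ (closureEmb (K := ℚ) (v.adicCompletion ℚ)) W dd
      (localLayerPointsOfEmb_le_localTowerPointsOfEmb κ (closureEmb (K := ℚ) (v.adicCompletion ℚ)) W n (Q₀ i).2)
  · -- the values on `Gal(ℚ̄_v/ℚ_{∞,v}) ≤ U_n`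
    have hτn : (τ : absoluteGaloisGroup (v.adicCompletion ℚ)) ∈ layerGroup κ v n :=
      κ.kerSubgroup_le_layerSubgroup n ((mem_localSubgroupOfEmb_iff κ.kerSubgroup (closureEmb (K := ℚ) (v.adicCompletion ℚ)) _).1 τ.2)
    have e2 : subgroupInclusion (κ.kerSubgroup_le_layerSubgroup n)
        (resGalSubgroupOfEmb κ.kerSubgroup (closureEmb (K := ℚ) (v.adicCompletion ℚ)) τ) =
        resGalSubgroupOfEmb (κ.layerSubgroup n) (closureEmb (K := ℚ) (v.adicCompletion ℚ))
          ⟨(τ : absoluteGaloisGroup (v.adicCompletion ℚ)), hτn⟩ :=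
      Subtype.ext rfl
    rw [contOneCocycles.pullback_apply, contOneCocycles.pullback_apply]
    change pointsMapOfEmb W (closureEmb (K := ℚ) (v.adicCompletion ℚ)) ((Θ ((((conjCocycle (κ.layerSubgroup n)
      (resGalOfEmb (closureEmb (K := ℚ) (v.adicCompletion ℚ)) dd) β).1
      (subgroupInclusion (κ.kerSubgroup_le_layerSubgroup n)
        (resGalSubgroupOfEmb κ.kerSubgroup (closureEmb (K := ℚ) (v.adicCompletion ℚ)) τ)) :
          ↥(AddSubgroup.torsionBy (Cofree ρ ↥(padicCoeffField S)) ((p ^ k : ℕ) : ℤ))) :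
        Cofree ρ ↥(padicCoeffField S))) i : ↥(W.geomPrimaryTorsion p)) : W.geomPoints) = _
    rw [e2]
    exact thetaKummerWitness_conj S ρ W Θ κ v hΘ n dd hβ ⟨_, hτn⟩ i

end OnePlace

/-! ## §3 (M) The transferred class lies in SelRel₍C4₎ — and §4 GLUE-67 typed -/

section Family

variable {p : ℕ} [Fact p.Prime] (S : Set (PadicAlgCl p)) {d : ℕ} (ρ : FramedGaloisRep ℚ ↥(padicCoeffIntegers S) d)
  (k : ℕ) (W : WeierstrassCurve ℚ) [W.IsElliptic] {r : ℕ} (κ : ZpExtension ℚ p) (n : ℕ)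
  (Θ : ∀ v : HeightOneSpectrum (𝓞 ℚ), (p : 𝓞 ℚ) ∈ v.asIdeal →
    (Cofree ρ ↥(padicCoeffField S) ≃+ (Fin r → ↥(W.geomPrimaryTorsion p))))
  (hΘ : ∀ (v : HeightOneSpectrum (𝓞 ℚ)) (hv : (p : 𝓞 ℚ) ∈ v.asIdeal) (δ : absoluteGaloisGroup (v.adicCompletion ℚ))
    (m : Cofree ρ ↥(padicCoeffField S)) (i : Fin r),
    Θ v hv (resGalOfEmb (closureEmb (K := ℚ) (v.adicCompletion ℚ)) δ • m) i =
      resGalOfEmb (closureEmb (K := ℚ) (v.adicCompletion ℚ)) δ • Θ v hv m i)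
  [Fintype (absoluteGaloisGroup ℚ ⧸ κ.layerSubgroup n)]
  {s : absoluteGaloisGroup ℚ ⧸ κ.layerSubgroup n → absoluteGaloisGroup ℚ}
  (hs : ∀ x : absoluteGaloisGroup ℚ ⧸ κ.layerSubgroup n, (s x : absoluteGaloisGroup ℚ ⧸ κ.layerSubgroup n) = x)
  (hs1 : s ((1 : absoluteGaloisGroup ℚ) : absoluteGaloisGroup ℚ ⧸ κ.layerSubgroup n) = 1)
  {S₀ : Set (HeightOneSpectrum (𝓞 ℚ))} (hκ : κ.IsCyclotomic)
  (hρ : ∀ w : HeightOneSpectrum (𝓞 ℚ), w ∉ S₀ → ((p : ℕ) : 𝓞 ℚ) ∉ w.asIdeal → ρ.IsUnramifiedAt w)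
  (c : H1 (cofreeTorsionGaloisModule S ρ ((p ^ k : ℕ) : ℤ)) (κ.layerSubgroup n))
  (hur : ∀ w : HeightOneSpectrum (𝓞 ℚ), w ∉ S₀ → ((p : ℕ) : 𝓞 ℚ) ∉ w.asIdeal →
    galoisCohomology.localization
        ((cofreeTorsionGaloisModule S ρ ((p ^ k : ℕ) : ℤ)).coind (κ.layerSubgroup n) (κ.isOpen_layerSubgroup n)) (Sum.inr w) 1
        (shapiroLift (cofreeTorsionGaloisModule S ρ ((p ^ k : ℕ) : ℤ)).toTopRep (κ.layerSubgroup n) (κ.isOpen_layerSubgroup n)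
          hs hs1 c) ∈
      unramifiedSubgroup (GaloisRep.toLocal w
        ((cofreeTorsionGaloisModule S ρ ((p ^ k : ℕ) : ℤ)).coind (κ.layerSubgroup n) (κ.isOpen_layerSubgroup n))) 1)
  (hinf : ∀ w : InfinitePlace ℚ,
    galoisCohomology.localization
        ((cofreeTorsionGaloisModule S ρ ((p ^ k : ℕ) : ℤ)).coind (κ.layerSubgroup n) (κ.isOpen_layerSubgroup n)) (Sum.inl w) 1
        (shapiroLift (cofreeTorsionGaloisModule S ρ ((p ^ k : ℕ) : ℤ)).toTopRep (κ.layerSubgroup n) (κ.isOpen_layerSubgroup n)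
          hs hs1 c) = 0)
  (v : HeightOneSpectrum (𝓞 ℚ)) (hv : (p : 𝓞 ℚ) ∈ v.asIdeal)
  (Q₀ : Fin r → ↥(localLayerPointsOfEmb κ (closureEmb (K := ℚ) (v.adicCompletion ℚ)) W n))
  (hkum : layerLocOf (cofreeTorsionGaloisModule S ρ ((p ^ k : ℕ) : ℤ)) κ v n c =
    thetaLayerKummer S ρ k W (Θ v hv) κ v (hΘ v hv) n Q₀)

include hκ hρ hur hinf hv hkum in
/-- **(M) `τ_n c ∈ SelRel₍C4₎`.** [unr] ∧ [inf] (LOCAL CONDITIONS on the Shapiro lift `Sh c`: membership in the DUAL structure of the level call) ∧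
[kum] at THE place `v ∋ p` (`layerLocOf … κ v n c = thetaLayerKummer … (Θ v hv) … Q₀`, ANY layer points `Q₀`) ⟹ the transferred class
`τ_n c ∈ H¹(Γ_∞, A_ρ)` satisfies: (1) unramified outside `p ∪ S₀`, (2) archimedean, and (3♭) for every place `v' ∋ p` (over `ℚ` only `v' = v`) and
every `σ` a RELAXED tower-points Θ-Kummer datum — literally the three clauses of SelRel₍C4₎ (SKELETON-V2-CUT-g16 (C4); there `p = 2`, rank `n`).
[cite: GreenbergVatsal2000, §2 pp. 16–17, 23] [cite: Greenberg1989, §1 p. 98 (3)] [cite: Kobayashi2003, Def. 1.1] [cite: Sprung2012, Lemma 7.10] -/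
theorem transferH1_mem_selRel_of_shapiroLift :
    resOfLe (Cofree ρ ↥(padicCoeffField S)) (κ.kerSubgroup_le_layerSubgroup n)
        (pushH1 (κ.layerSubgroup n) (AddSubgroup.torsionBy (Cofree ρ ↥(padicCoeffField S)) ((p ^ k : ℕ) : ℤ)).subtype
          (torsionBy_subtype_smul S ρ ((p ^ k : ℕ) : ℤ)) c) ∈
      {y : subgroupH1 κ.kerSubgroup (Cofree ρ ↥(padicCoeffField S)) |
        y ∈ unramifiedOutside κ.kerSubgroup (Cofree ρ ↥(padicCoeffField S)) p S₀ ∧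
        (∀ w σ, conjH1 κ.kerSubgroup (Cofree ρ ↥(padicCoeffField S)) σ y ∈
          infKer κ.kerSubgroup (Cofree ρ ↥(padicCoeffField S)) w) ∧
        ∀ (v' : HeightOneSpectrum (𝓞 ℚ)) (hv' : (p : 𝓞 ℚ) ∈ v'.asIdeal) (σ : absoluteGaloisGroup ℚ),
          ∃ (φ : contOneCocycles (discreteTopRep κ.kerSubgroup (Cofree ρ ↥(padicCoeffField S))))
            (Q : Fin r → localPoints W (v'.adicCompletion ℚ)) (k' : ℕ),
            oneCocycleClass (discreteTopRep κ.kerSubgroup (Cofree ρ ↥(padicCoeffField S))) φ =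
              conjH1 κ.kerSubgroup (Cofree ρ ↥(padicCoeffField S)) σ y ∧
            (∀ i, (p ^ k') • Q i ∈ localTowerPointsOfEmb κ (closureEmb (K := ℚ) (v'.adicCompletion ℚ)) W) ∧
            ∀ (τ : localSubgroupOfEmb κ.kerSubgroup (closureEmb (K := ℚ) (v'.adicCompletion ℚ))) (i : Fin r),
              pointsMapOfEmb W (closureEmb (K := ℚ) (v'.adicCompletion ℚ))
                  ((Θ v' hv' (φ.1 (resGalSubgroupOfEmb κ.kerSubgroup (closureEmb (K := ℚ) (v'.adicCompletion ℚ)) τ)) i :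
                    ↥(W.geomPrimaryTorsion p)) : W.geomPoints) =
                (τ : absoluteGaloisGroup (v'.adicCompletion ℚ)) • Q i - Q i} := by
  obtain ⟨h1, h2⟩ := transferH1_mem_relaxed_of_shapiroLift S ρ κ ((p ^ k : ℕ) : ℤ) n hs hs1 hρ c hur hinf
  refine ⟨h1, h2, fun v' hv' σ ↦ ?_⟩
  have e := heightOneSpectrum_eq_of_natCast_mem (Fact.out : p.Prime) hv hv'
  subst e
  exact exists_tower_thetaKummerWitness_conjH1_transfer S ρ k W (Θ _ hv') κ _ (hΘ _ hv') hκ hv' n c Q₀ hkum σ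

include hκ hρ hur hinf hkum in
/-- **GLUE-67 typed (S86): (M) + (V) + (VAL-rel) + (H) ⟹ `z(Q₀) ≡ 0 (mod p^k)`.** Let `Rel` contain SelRel₍C4₎'s literal (§3; `Rel :=` the literal
itself, or any larger test set the split text quantifies over), `C : H¹(Γ_∞, A_ρ) → ℚ/ℤ` be the split's functional `s ↦ c₂ z (loc₂ s)` with its
SelRel-wide VALUE pin (VAL-rel) «`C s = (z(p^k' • Q) mod p^k')·p^{-k'}` for every tower datum `(φ, Q, k')` of `s ∈ Rel` at `v`» (S2's (VAL)
formula on tower data, Q88), and (H) «`C = 0` on `Rel`» be the item-6 hypothesis. Then for every level class `c` in the dual structure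
([unr] ∧ [inf]) with [kum] `layerLocOf … c = thetaLayerKummer … (Θ v hv) … Q₀`: `PadicInt.toZModPow k (z Q₀) = 0` — the conclusion of the
levelwise orthogonality `hT` of `…DeepHalfAtTwoLevelwise` (p694426). Proof: (M) `τ_n c ∈ Rel` (§3); (V) the exact datum `(φ, R, k)` with
`p^k • R = Q₀` (§1) is a tower datum; (VAL-rel) + (H) give `(z(Q₀) mod p^k)·p^{-k} = 0` in `ℚ/ℤ`, and `p^{-k}` has order `p^k`
(`SignedLowerOffTwo.PTDeep.toZModPow_eq_zero_of_val_smul_invPow_eq_zero`). [cite: MilneADT2006, I 4.10 (b)] [cite: Kobayashi2003, (8.23) (p. 18)]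
[cite: Rubin2000, App. B §B.3] -/
theorem toZModPow_eq_zero_of_transfer
    (Rel : Set (subgroupH1 κ.kerSubgroup (Cofree ρ ↥(padicCoeffField S))))
    (hRel : {y : subgroupH1 κ.kerSubgroup (Cofree ρ ↥(padicCoeffField S)) |
        y ∈ unramifiedOutside κ.kerSubgroup (Cofree ρ ↥(padicCoeffField S)) p S₀ ∧
        (∀ w σ, conjH1 κ.kerSubgroup (Cofree ρ ↥(padicCoeffField S)) σ y ∈
          infKer κ.kerSubgroup (Cofree ρ ↥(padicCoeffField S)) w) ∧
        ∀ (v' : HeightOneSpectrum (𝓞 ℚ)) (hv' : (p : 𝓞 ℚ) ∈ v'.asIdeal) (σ : absoluteGaloisGroup ℚ),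
          ∃ (φ : contOneCocycles (discreteTopRep κ.kerSubgroup (Cofree ρ ↥(padicCoeffField S))))
            (Q : Fin r → localPoints W (v'.adicCompletion ℚ)) (k' : ℕ),
            oneCocycleClass (discreteTopRep κ.kerSubgroup (Cofree ρ ↥(padicCoeffField S))) φ =
              conjH1 κ.kerSubgroup (Cofree ρ ↥(padicCoeffField S)) σ y ∧
            (∀ i, (p ^ k') • Q i ∈ localTowerPointsOfEmb κ (closureEmb (K := ℚ) (v'.adicCompletion ℚ)) W) ∧
            ∀ (τ : localSubgroupOfEmb κ.kerSubgroup (closureEmb (K := ℚ) (v'.adicCompletion ℚ))) (i : Fin r),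
              pointsMapOfEmb W (closureEmb (K := ℚ) (v'.adicCompletion ℚ))
                  ((Θ v' hv' (φ.1 (resGalSubgroupOfEmb κ.kerSubgroup (closureEmb (K := ℚ) (v'.adicCompletion ℚ)) τ)) i :
                    ↥(W.geomPrimaryTorsion p)) : W.geomPoints) =
                (τ : absoluteGaloisGroup (v'.adicCompletion ℚ)) • Q i - Q i} ⊆ Rel)
    (C : subgroupH1 κ.kerSubgroup (Cofree ρ ↥(padicCoeffField S)) → AddCircle (1 : ℚ))
    (z : (Fin r → ↥(localTowerPointsOfEmb κ (closureEmb (K := ℚ) (v.adicCompletion ℚ)) W)) → ℤ_[p])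
    (hval : ∀ s ∈ Rel, ∀ (φ : contOneCocycles (discreteTopRep κ.kerSubgroup (Cofree ρ ↥(padicCoeffField S))))
      (Q : Fin r → localPoints W (v.adicCompletion ℚ)) (k' : ℕ)
      (hQ : ∀ i, (p ^ k') • Q i ∈ localTowerPointsOfEmb κ (closureEmb (K := ℚ) (v.adicCompletion ℚ)) W),
      oneCocycleClass (discreteTopRep κ.kerSubgroup (Cofree ρ ↥(padicCoeffField S))) φ = s →
      (∀ (τ : localSubgroupOfEmb κ.kerSubgroup (closureEmb (K := ℚ) (v.adicCompletion ℚ))) (i : Fin r),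
        pointsMapOfEmb W (closureEmb (K := ℚ) (v.adicCompletion ℚ))
            ((Θ v hv (φ.1 (resGalSubgroupOfEmb κ.kerSubgroup (closureEmb (K := ℚ) (v.adicCompletion ℚ)) τ)) i :
              ↥(W.geomPrimaryTorsion p)) : W.geomPoints) =
          (τ : absoluteGaloisGroup (v.adicCompletion ℚ)) • Q i - Q i) →
      C s = (PadicInt.toZModPow k' (z (fun i ↦ ⟨(p ^ k') • Q i, hQ i⟩))).val • ((((p : ℚ) ^ k')⁻¹ : ℚ) : AddCircle (1 : ℚ)))
    (hH : ∀ s ∈ Rel, C s = 0) :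
    PadicInt.toZModPow k (z (fun i ↦ ⟨(Q₀ i : localPoints W (v.adicCompletion ℚ)),
      localLayerPointsOfEmb_le_localTowerPointsOfEmb κ (closureEmb (K := ℚ) (v.adicCompletion ℚ)) W n (Q₀ i).2⟩)) = 0 := by
  -- (M): the transferred class is a test class
  have hy := hRel (transferH1_mem_selRel_of_shapiroLift S ρ k W κ n Θ hΘ hs hs1 hκ hρ c hur hinf v hv Q₀ hkum)
  -- (V): its exact datum at `σ = 1`
  obtain ⟨φ, R, hφ, hR, hident⟩ := exists_thetaKummerWitness_transfer S ρ k W (Θ v hv) κ v (hΘ v hv) n c Q₀ hkum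
  have hQ : ∀ i, (p ^ k) • R i ∈ localTowerPointsOfEmb κ (closureEmb (K := ℚ) (v.adicCompletion ℚ)) W := fun i ↦ by
    rw [hR i]
    exact localLayerPointsOfEmb_le_localTowerPointsOfEmb κ (closureEmb (K := ℚ) (v.adicCompletion ℚ)) W n (Q₀ i).2
  -- (VAL-rel) on that datum, (H) on the test class
  have hv0 := hval _ hy φ R k hQ hφ hident
  rw [hH _ hy] at hv0
  have htuple : (fun i ↦ (⟨(p ^ k) • R i, hQ i⟩ : ↥(localTowerPointsOfEmb κ (closureEmb (K := ℚ) (v.adicCompletion ℚ)) W))) =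
      fun i ↦ ⟨(Q₀ i : localPoints W (v.adicCompletion ℚ)),
        localLayerPointsOfEmb_le_localTowerPointsOfEmb κ (closureEmb (K := ℚ) (v.adicCompletion ℚ)) W n (Q₀ i).2⟩ :=
    funext fun i ↦ Subtype.ext (hR i)
  rw [htuple] at hv0
  exact SignedLowerOffTwo.PTDeep.toZModPow_eq_zero_of_val_smul_invPow_eq_zero k _ hv0.symm

end Family

end Summit.BirchSwinnertonDyer.BirchSwinnertonDyer.Theorems.ThetaTransport.CofreeSelmerTransfer

end
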